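import Literature.AnabelianGeometry.AbsoluteAnabelian.GaloisCyclotomeTransportNaturality
import HarnessLib

/-!
# [AbsTopIII] Rmk. 3.2.1 naturality for EVERY torsion reciprocity datum (`Ẑˣ`-twist invariance)

S. Mochizuki, *Topics in Absolute Anabelian Geometry III*, Rmk. 3.2.1 p. 73 / Cor. 1.10 (i)(a),(c) p. 42; *The
Absolute Anabelian Geometry of Hyperbolic Curves* (2004) [AbsAnab], Prop. 1.2.1 (vi) p. 10 («… induce an isomorphism
`μ_{ℚ/ℤ}(K̄₁) ⥲ μ_{ℚ/ℤ}(K̄₂)` which is Galois-equivariant with respect to `α`»).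

PROOF-ONLY sequel (abc-iut-L6-t11, row «RMK321-NAT») of `GaloisCyclotomeTransportNaturality.lean`.  There the
naturality `D.muLift ∘ μ_{ℚ/ℤ}(φ) = ψ̄_φ ∘ D.muLift` (every topological automorphism `φ` of `G_k`, THE units transport
`ψ̄_φ`) is proved for THE local-class-field-theory datum `D` (torsion of `Art⁻¹` through the Verlagerung).  Consumers of
the abc-iut tree, however, hold their OWN `D : TorsionReciprocityData k` (the parameter `D` of
`GaloisPairCyclotomesGenuineRigidity*`, the `ι_{G↷M}` of `Summits/ABC/IUTFork/LanaCyclotomicRigidityModel`, every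
`obtain ⟨D⟩ := nonempty_torsionReciprocityData k`).  THIS FILE removes the dependence on the choice: naturality holds for
EVERY `D`.  Reason (classical): two data `D`, `D₀` give two `G_k`-equivariant identifications of `μ_{ℚ/ℤ}(G_k)` with the
roots of unity, so `e := D₀.equiv⁻¹ ∘ D.equiv` is an automorphism of the torsion group `μ_{ℚ/ℤ}(G_k)`, whose
`n`-torsion is cyclic for every `n` (it is `μ_n(k̄)`); any two endomorphisms of such a group commute (both act on a
generator of the `n`-torsion by integer multiples), in particular `e` commutes with `μ_{ℚ/ℤ}(φ)` — the twist by a unit of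
`Ẑ` is invisible to naturality.

* (private) `addMonoidHom_apply_comm_of_cyclic_torsion` — endomorphisms of an abelian group whose every element lies in a
  finite cyclic torsion level commute (pure algebra);
* `TorsionReciprocityData.exists_cyclic_torsion_level` — `μ_{ℚ/ℤ}(G_k)` is such a group (transport of
  `rootsOfUnity.isCyclic` along `D.equiv`);
* `TorsionReciprocityData.toMul_muLift_map_natural` / `muZhatEquiv_congr_natural` — for EVERY `D`, every `φ`, every
  `φ`-equivariant uniformiser-preserving `ψ̄`: `D.muLift (μ_{ℚ/ℤ}(φ) z) = ψ̄ (D.muLift z)` and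
  `D.muZhatEquiv (μ_Ẑ(φ) y) = Λ(ψ̄) (D.muZhatEquiv y)`.

Classical; theorems only, no definitions, no named facts; universe `0`.  HONEST FRAMING: nothing here bears on
[IUTchIII] Cor. 3.12; no side is taken.
-/

noncomputable section

open Field

namespace Literature.AnabelianGeometry.AbsoluteAnabelian

/-! ### §1 Endomorphisms of a group with cyclic torsion levels commute -/

/-- **Endomorphisms of a «locally cyclic» torsion abelian group commute.**  If every `x ∈ A` is killed by some
`n ≥ 1` whose `n`-torsion `A[n]` is generated by one element `y`, then any two additive endomorphisms `f`, `g` of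
`A` commute: on `A[n] = ℤ·y` both are integer multiplications.  (Used for `A = μ_{ℚ/ℤ}(G_k) ≅ μ(k̄)`, whose
`n`-torsion is the cyclic group `μ_n(k̄)`.) [folklore] -/
private theorem addMonoidHom_apply_comm_of_cyclic_torsion {A : Type*} [AddCommGroup A]
    (hcyc : ∀ x : A, ∃ (n : ℕ) (y : A), n • x = 0 ∧ n • y = 0 ∧ ∀ z : A, n • z = 0 → ∃ a : ℤ, z = a • y)
    (f g : A →+ A) (x : A) : f (g x) = g (f x) := by
  obtain ⟨n, y, hx, hy, hgen⟩ := hcyc x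
  obtain ⟨a, ha⟩ := hgen x hx
  have hfy : n • f y = 0 := by rw [← map_nsmul, hy, map_zero]
  have hgy : n • g y = 0 := by rw [← map_nsmul, hy, map_zero]
  obtain ⟨b, hb⟩ := hgen (f y) hfy
  obtain ⟨c, hc⟩ := hgen (g y) hgy
  simp only [ha, map_zsmul, hb, hc, smul_smul]
  congr 1
  ring

/-! ### §2 `μ_{ℚ/ℤ}(G_k)` has cyclic torsion levels -/

namespace TorsionReciprocityData

universe u

variable {k : Type u} [Field k] [CharZero k]

/-- **Every class of `μ_{ℚ/ℤ}(G_k)` lies in a cyclic torsion level**: for `x ∈ μ_{ℚ/ℤ}(G_k)` of order `n`, the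
`n`-torsion of `μ_{ℚ/ℤ}(G_k)` is generated by one element — the transport along `D.equiv : μ_{ℚ/ℤ}(G_k) ≃ (k̄ˣ)_tors`
of a generator of the cyclic group `μ_n(k̄)` (`rootsOfUnity.isCyclic`). [cite: MochizukiAbsTopIII2015, Cor 1.10 (i) p.42] -/
theorem exists_cyclic_torsion_level (D : TorsionReciprocityData k) (x : muQZ (absoluteGaloisGroup k)) :
    ∃ (n : ℕ) (y : muQZ (absoluteGaloisGroup k)), n • x = 0 ∧ n • y = 0 ∧
      ∀ z : muQZ (absoluteGaloisGroup k), n • z = 0 → ∃ a : ℤ, z = a • y := by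
  classical
  set n := addOrderOf x with hn
  have hnpos : 0 < n := (muQZ.isOfFinAddOrder x).addOrderOf_pos
  haveI : NeZero n := ⟨hnpos.ne'⟩
  -- a generator of `μ_n(k̄)`
  obtain ⟨g, hg⟩ := exists_zpow_surjective (rootsOfUnity n (AlgebraicClosure k))
  have hgn : ((g : rootsOfUnity n (AlgebraicClosure k)) : (AlgebraicClosure k)ˣ) ^ n = 1 :=
    (mem_rootsOfUnity n _).mp g.2
  have hgtors : ((g : rootsOfUnity n (AlgebraicClosure k)) : (AlgebraicClosure k)ˣ) ∈
      CommGroup.torsion (AlgebraicClosure k)ˣ :=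
    (CommGroup.mem_torsion _).mpr (isOfFinOrder_iff_pow_eq_one.mpr ⟨n, hnpos, hgn⟩)
  let y' : CommGroup.torsion (AlgebraicClosure k)ˣ := ⟨_, hgtors⟩
  refine ⟨n, D.equiv.symm (Additive.ofMul y'), addOrderOf_nsmul_eq_zero x, ?_, ?_⟩
  · -- `n • y = 0`
    apply D.equiv.injective
    rw [map_nsmul, AddEquiv.apply_symm_apply, map_zero, ← ofMul_pow, ← ofMul_one]
    exact congrArg Additive.ofMul (Subtype.ext (by rw [SubmonoidClass.coe_pow]; exact hgn))
  · -- every `n`-torsion class is an integer multiple of `y`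
    intro z hz
    set t := Additive.toMul (D.equiv z) with ht
    have htn : ((t : CommGroup.torsion (AlgebraicClosure k)ˣ) : (AlgebraicClosure k)ˣ) ^ n = 1 := by
      have h1 : D.equiv (n • z) = 0 := by rw [hz, map_zero]
      rw [map_nsmul] at h1
      have h2 : t ^ n = 1 := by
        rw [ht, ← toMul_nsmul, h1, toMul_zero]
      rw [← SubmonoidClass.coe_pow, h2, OneMemClass.coe_one]
    obtain ⟨a, ha⟩ := hg ⟨(t : (AlgebraicClosure k)ˣ), (mem_rootsOfUnity n _).mpr htn⟩
    have ha' : ((g : rootsOfUnity n (AlgebraicClosure k)) : (AlgebraicClosure k)ˣ) ^ a =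
        (t : (AlgebraicClosure k)ˣ) := by
      have := congrArg (fun w : rootsOfUnity n (AlgebraicClosure k) => (w : (AlgebraicClosure k)ˣ)) ha
      simpa using this
    refine ⟨a, ?_⟩
    apply D.equiv.injective
    rw [map_zsmul, AddEquiv.apply_symm_apply, ← ofMul_zpow]
    change Additive.ofMul t = _
    congr 1
    exact Subtype.ext (by rw [SubgroupClass.coe_zpow]; exact ha'.symm)

end TorsionReciprocityData

/-! ### §3 Naturality for EVERY datum -/

namespace TorsionReciprocityData

variable {k : Type} [Field k] [ValuativeRel k] [TopologicalSpace k] [IsNonarchimedeanLocalField k] [CharZero k]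

/-- **[AbsTopIII] Rmk. 3.2.1 naturality for EVERY torsion reciprocity datum.**  For ANY `D : TorsionReciprocityData k`
(T1–T4), every topological automorphism `φ` of `G_k` and every `φ`-equivariant uniformiser-preserving
`ψ̄ : k̄ˣ ⥲ k̄ˣ`: `D.muLift (μ_{ℚ/ℤ}(φ) z) = ψ̄ (D.muLift z)`.  Proof: with `D₀` the LCFT datum of
`exists_torsionReciprocityData_natural` and `e := D₀.equiv⁻¹ ∘ D.equiv` (an automorphism of `μ_{ℚ/ℤ}(G_k)` with
`D.muLift = D₀.muLift ∘ e`), `e` commutes with `μ_{ℚ/ℤ}(φ)` (private `addMonoidHom_apply_comm_of_cyclic_torsion`), so the statement for `D₀`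
transports to `D`. [cite: MochizukiAbsTopIII2015, Remark 3.2.1 p.73] -/
theorem toMul_muLift_map_natural (D : TorsionReciprocityData k)
    (φ : absoluteGaloisGroup k ≃ₜ* absoluteGaloisGroup k) (ψ : (AlgebraicClosure k)ˣ ≃* (AlgebraicClosure k)ˣ)
    (hψ : Prop121vii.IsAlphaEquivariant φ ψ) (hU : Prop121vii.PreservesUniformizers ψ)
    (z : muQZ (absoluteGaloisGroup k)) :
    Additive.toMul (D.muLift (muQZ.map φ z)) = ψ (Additive.toMul (D.muLift z)) := by
  obtain ⟨D₀, hD₀⟩ := exists_torsionReciprocityData_natural k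
  -- the twist `e := D₀.equiv⁻¹ ∘ D.equiv` and `D.muLift = D₀.muLift ∘ e`
  let e : muQZ (absoluteGaloisGroup k) →+ muQZ (absoluteGaloisGroup k) :=
    (D.equiv.trans D₀.equiv.symm : muQZ (absoluteGaloisGroup k) ≃+ muQZ (absoluteGaloisGroup k)).toAddMonoidHom
  have he : ∀ w, Additive.toMul (D₀.muLift (e w)) = Additive.toMul (D.muLift w) := by
    intro w
    have h1 : D₀.equiv (e w) = D.equiv w := D₀.equiv.apply_symm_apply _
    have h2 := congrArg (fun t : Additive (CommGroup.torsion (AlgebraicClosure k)ˣ) =>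
      ((Additive.toMul t : CommGroup.torsion (AlgebraicClosure k)ˣ) : (AlgebraicClosure k)ˣ)) h1
    simpa only [equiv, AddEquiv.ofBijective_apply, coe_muTorsionHom] using h2
  -- `e` commutes with `μ_{ℚ/ℤ}(φ)`
  have hcomm : e (muQZ.map φ z) = muQZ.map φ (e z) :=
    addMonoidHom_apply_comm_of_cyclic_torsion D.exists_cyclic_torsion_level e (muQZ.map φ) z
  rw [← he, hcomm, (hD₀ φ ψ hψ hU).1, he]

/-- **The `μ_Ẑ`-form for EVERY datum**: `D.muZhatEquiv (μ_Ẑ(φ) y) = Λ(ψ̄) (D.muZhatEquiv y)` for ANY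
`D : TorsionReciprocityData k` — the hypothesis `hN`/(b1) of the abc-iut cell's `GaloisPairCyclotomesGenuineRigidity*`
files at the consumer's own `D`. [cite: MochizukiAbsTopIII2015, Remark 3.2.1 p.73] -/
theorem muZhatEquiv_congr_natural (D : TorsionReciprocityData k)
    (φ : absoluteGaloisGroup k ≃ₜ* absoluteGaloisGroup k) (ψ : (AlgebraicClosure k)ˣ ≃* (AlgebraicClosure k)ˣ)
    (hψ : Prop121vii.IsAlphaEquivariant φ ψ) (hU : Prop121vii.PreservesUniformizers ψ)
    (y : muZhat (absoluteGaloisGroup k)) :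
    D.muZhatEquiv (muZhat.congr φ y) = EtaleTheta.cyclotome.map ψ.toMonoidHom (D.muZhatEquiv y) := by
  refine Subtype.ext (funext fun n => Units.ext ?_)
  rw [muZhatEquiv_apply_coe, EtaleTheta.cyclotome.map_apply, muZhatEquiv_apply_coe, muZhat.coe_congr,
    muZhat.map_apply_coe, toAdd_ofAdd]
  have e₁ := D.coe_muTorsionHom (Multiplicative.toAdd ((y : ℕ+ → Multiplicative (muQZ _)) n))
  have e₂ := D.coe_muTorsionHom (muQZ.map φ (Multiplicative.toAdd ((y : ℕ+ → Multiplicative (muQZ _)) n)))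
  change (((Additive.toMul (D.muTorsionHom _) : CommGroup.torsion (AlgebraicClosure k)ˣ) :
      (AlgebraicClosure k)ˣ) : AlgebraicClosure k) =
    ((ψ.toMonoidHom ((Additive.toMul (D.muTorsionHom _) : CommGroup.torsion (AlgebraicClosure k)ˣ) :
      (AlgebraicClosure k)ˣ) : (AlgebraicClosure k)ˣ) : AlgebraicClosure k)
  rw [e₁, e₂, MulEquiv.coe_toMonoidHom, D.toMul_muLift_map_natural φ ψ hψ hU]

end TorsionReciprocityData

end Literature.AnabelianGeometry.AbsoluteAnabelian
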